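/-
Copyright (c) 2026 the pub-hodgecm-mathlib formalisation cell (harness21).  Prover seat hodgecm-mathlib-F0P3a-p04 (g31), 2026-09-03.  E1 row 41f «(SS-K) UNIFORM, GENERIC», FILE B1
(E1 keeper ∕ dealer F0P3a-p03 (g29) 01:48:31Z ∕ 02:01:13Z; census row 38 `CENSUS-SSK-via-resolution.v1` a09ddab6d77c6082 §3 (A7)-inputs ∕ §5 R-f).
-/
import Literature.NumberTheory.Automorphic.SchneiderStuhlerTreeComplexAction   -- ★ 41d FILE II (F0P3-p02): `rep_zeroChains_apply`, `rep_oneChains_apply`, `act_act_inv`; brings ★ FILE I (`mem_zeroChains_iff`, `mem_oneChains_iff`)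
import Literature.NumberTheory.Automorphic.SmoothCharacterCosetTrace          -- ★ TRACE-COSET (F0P3a-p03): `levelTrace_eq_trace_restrict_of_mem_normalizer`, `apply_mem_fixedPoints_of_mem_normalizer`
import Literature.Combinatorics.SimpleGraph.FixedSetLocallyConstant           -- ★ 41a: `mapEdgeSet_eq_self_of_forall_apply_eq`
import HarnessLib

/-!
# The finite Schneider–Stuhler complex of a stable subtree, III: the three `P`-representations are SMOOTH, and the `K`-invariants of `V|_Σ` are `V^K`
# (inputs (A7)∕(A8) of the uniform character formula — Meyer–Solleveld 2010 Prop. 4.1; Korman 2004 §9)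

Topic `NumberTheory/Automorphic` (declarations in the `Representation` namespace, next to ★ 41d `SchneiderStuhlerTreeComplexFinite` ∕ `…Action`).  THEOREMS ONLY (no definition,
no instance, no notation, no named fact, no `sorry`).  Cell `pub/hodgecm-mathlib` (D-0151), crux H413 = `stmt-HodgeConjecture-24833`, lane `--supports`; E1 BRICK LEDGER row 41f
(keeper F0P3a-p03 (g29)), census row 38 §5 R-f: the two facts ★ 41e «invariants of a compact group are exact» and ★ `trace_eq_add_of_exact` need about the complex of ★ 41d —
SMOOTHNESS of `ρ₁, ρ₀, ρV` (so that `e_K` exists on `C₁(S)`, `C₀(S)`) and the identification `(V|_Σ)^K = V^K` under `V^K ≤ V|_Σ` (the generation hypothesis, ★ 41c).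
HONEST LABEL: count-neutral generic base layer; E1 = PRINT until the keeper's charter test; (R-SS) NOT chartered; HC_CM is proved only modulo the 2 remaining named inputs
(hLiu418 = `stmt-HodgeConjecture-24832`, h413 = `stmt-HodgeConjecture-24833`) until rung 0 closes.

THE MATHEMATICS.  Letters of ★ 41d FILE II: `P ≤ Γ` stabilises the finite vertex set `S`; `ρ₀ : P → GL(C₀(S))` agrees with `τ` (`(g·v)(x) = ρ(g) v(g⁻¹x)`), `ρ₁` with `τ₁`, `ρV` with
`ρ` on `V|_Σ = ⨆_{x∈S} V^{U_x}`.  (§1) A `0`-chain `v ∈ C₀(S)` has finite support in `S` with `v_x ∈ V^{U_x}`; every `g` in the OPEN set `⋂_{x ∈ supp v} (Stab(x) ∩ U_x)` fixes it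
(vertex stabilisers open, `U_x` open), so its stabiliser in `P` is open: `ρ₀` is smooth; likewise `ρ₁` (an automorphism fixing both ends of an edge fixes the edge, ★ 41a) and
`ρV` (a sub-representation of the smooth `ρ`).  (§2) For `K ≤ P` and `γ ∈ P ∩ N_Γ(K)`: `w ∈ V|_Σ` is fixed by `K ∩ P` iff `w ∈ V^K`; if `V^K ≤ V|_Σ` this is a linear equivalence
`(V|_Σ)^{K∩P} ≃ V^K` conjugating the two actions of `γ`, so `tr(γ | (V|_Σ)^{K∩P}) = tr(γ | V^K) = Θ_K(γ)` (★ TRACE-COSET `levelTrace`).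

* §1 `act_inv_eq_of_act_eq`, `isSmooth_rep_zeroChains`, `isSmooth_rep_oneChains`, `isSmooth_rep_restricted`.
* §2 `mk_mem_normalizer_subgroupOf`, `mem_fixedPoints_restricted_iff`, **`trace_fixedPoints_restricted_eq_levelTrace`**.

## References
* [MeyerSolleveld2010] R. Meyer, M. Solleveld, *Resolutions for representations of reductive p-adic groups via their buildings*, J. reine angew. Math. 647 (2010): §4 Prop. 4.1
  («`C(Σ, Γ(V))` is a chain complex of `𝒢`-representations» — finite-dimensional smooth modules of the compact open `𝒢`).
* [Korman2004] J. Korman, *A character formula for compact elements (the rank one case)*, arXiv:math/0409292: §9 Claim 39 (the auxiliary `K`, `γ` normalises `K`).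
* [SchneiderStuhler1997] P. Schneider, U. Stuhler, *Representation theory and sheaves on the Bruhat–Tits building*, Publ. Math. IHÉS 85 (1997): Ch. II §3 p. 123, Ch. III §4.
* [Serre1980Trees] J.-P. Serre, *Trees* (1980): I.3.1 (no inversions).
-/

set_option autoImplicit false

open scoped BigOperators Pointwise
open SimpleGraph Finset
open Literature.NumberTheory.Automorphic Literature.Combinatorics.SimpleGraph Literature.Combinatorics.SimpleGraph.OrientedIncidence

namespace Representation

variable {k Γ V : Type*} [Field k] [CharZero k] [Group Γ] [TopologicalSpace Γ] [IsTopologicalGroup Γ]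
  [AddCommGroup V] [Module k V] {ρ : Representation k Γ V}
variable {ι : Type*} [DecidableEq ι] {G : SimpleGraph ι} {a : Γ →* (G ≃g G)}

/-! ## §1 The three `P`-representations of the finite complex are smooth -/

section Smooth

variable {τ : Representation k Γ (ι →₀ V)} (hτ : ∀ (g : Γ) (v : ι →₀ V), τ g v = Finsupp.mapRange (ρ g) (map_zero _) (Finsupp.equivMapDomain (a g).toEquiv v))
variable {τ₁ : Representation k Γ (G.edgeSet →₀ V)}
  (hτ₁ : ∀ (g : Γ) (c : G.edgeSet →₀ V), τ₁ g c = Finsupp.mapRange (ρ g) (map_zero _) (Finsupp.equivMapDomain (a g).mapEdgeSet c))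

omit [CharZero k] [TopologicalSpace Γ] [IsTopologicalGroup Γ] [DecidableEq ι] in
/-- `g⁻¹·x = x` when `g·x = x`. [cite: SchneiderStuhler1997, Ch. II §3 p. 123] -/
theorem act_inv_eq_of_act_eq {g : Γ} {x : ι} (hx : a g x = x) : a g⁻¹ x = x := by
  conv_lhs => rw [← hx]
  rw [map_inv]
  exact (a g).symm_apply_apply x

omit [CharZero k] in
include hτ in
/-- **`C₀(S)` IS A SMOOTH `P`-REPRESENTATION**: a `0`-chain `v` supported on the finite `S` with `v_x ∈ V^{U_x}` is fixed by the open set `⋂_{x ∈ supp v} (Stab(x) ∩ U_x)`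
(vertex stabilisers open, `U_x` open), so its stabiliser in `P` is an open subgroup. [cite: MeyerSolleveld2010, §4 Prop. 4.1] [cite: SchneiderStuhler1997, Ch. II §3 p. 123] -/
theorem isSmooth_rep_zeroChains (hstab : ∀ x : ι, IsOpen {g : Γ | a g x = x}) (U : ι → Subgroup Γ) (hUo : ∀ x, IsOpen (U x : Set Γ)) (S : Set ι)
    {P : Subgroup Γ} {ρ₀ : Representation k P ↥(⨆ x ∈ S, (ρ.fixedPoints (U x)).map (Finsupp.lsingle x : V →ₗ[k] ι →₀ V))}
    (hρ₀ : ∀ (g : P) v, ((ρ₀ g v : _) : ι →₀ V) = τ (g : Γ) v) : ρ₀.IsSmooth := by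
  classical
  intro w
  obtain ⟨-, hwfix⟩ := (mem_zeroChains_iff U S (w : ι →₀ V)).1 w.2
  -- the open set of `Γ` fixing every support vertex and lying in every `U_x`, `x ∈ supp w`
  set O : Set Γ := ⋂ x ∈ (w : ι →₀ V).support, ({g : Γ | a g x = x} ∩ (U x : Set Γ)) with hO
  have hOo : IsOpen O := isOpen_biInter_finset fun x _ => (hstab x).inter (hUo x)
  have hO1 : (1 : Γ) ∈ O := Set.mem_iInter₂.2 fun x _ => ⟨by simp, (U x).one_mem⟩
  have hfix : ∀ g : P, (g : Γ) ∈ O → ρ₀ g w = w := by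
    intro g hg
    have hg' : ∀ x ∈ (w : ι →₀ V).support, a (g : Γ) x = x ∧ (g : Γ) ∈ U x := fun x hx => Set.mem_iInter₂.1 hg x hx
    apply Subtype.ext
    rw [hρ₀]
    ext y
    rw [rep_zeroChains_apply hτ]
    by_cases hy : y ∈ (w : ι →₀ V).support
    · obtain ⟨hgy, hgU⟩ := hg' y hy
      rw [act_inv_eq_of_act_eq hgy]
      exact (ρ.mem_fixedPoints (U y) _).1 (hwfix y) _ hgU
    · have hy0 : (w : ι →₀ V) y = 0 := Finsupp.notMem_support_iff.1 hy
      have hy' : a (g : Γ)⁻¹ y ∉ (w : ι →₀ V).support := by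
        intro hmem
        obtain ⟨hfixy, -⟩ := hg' _ hmem
        have : a (g : Γ) (a (g : Γ)⁻¹ y) = y := act_act_inv (a := a) (g : Γ) y
        rw [hfixy] at this
        exact hy (this ▸ hmem)
      rw [Finsupp.notMem_support_iff.1 hy', map_zero, hy0]
  apply Subgroup.isOpen_of_mem_nhds (g := 1)
  refine mem_nhds_iff.2 ⟨((↑) : P → Γ) ⁻¹' O, fun g hg => (ρ₀.mem_stabilizerSubgroup w g).2 (hfix g hg), hOo.preimage continuous_subtype_val, ?_⟩
  exact hO1

omit [CharZero k] in
include hτ₁ in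
/-- **`C₁(S)` IS A SMOOTH `P`-REPRESENTATION** (invariant orientation): a `1`-chain `c` is fixed by `⋂_{e ∈ supp c} (Stab(head e) ∩ Stab(tail e) ∩ U_{head e})`, an open set.
[cite: MeyerSolleveld2010, §4 Prop. 4.1] [cite: SchneiderStuhler1997, Ch. II §3 p. 123] -/
theorem isSmooth_rep_oneChains (hstab : ∀ x : ι, IsOpen {g : Γ | a g x = x}) (σ : Orientation G) (U : ι → Subgroup Γ) (hUo : ∀ x, IsOpen (U x : Set Γ)) (S : Set ι)
    {P : Subgroup Γ} {ρ₁ : Representation k P ↥(⨆ e ∈ {e : G.edgeSet | σ.head e ∈ S ∧ σ.tail e ∈ S},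
      (ρ.fixedPoints (U (σ.head e) ⊔ U (σ.tail e))).map (Finsupp.lsingle e : V →ₗ[k] G.edgeSet →₀ V))}
    (hρ₁ : ∀ (g : P) c, ((ρ₁ g c : _) : G.edgeSet →₀ V) = τ₁ (g : Γ) c) : ρ₁.IsSmooth := by
  classical
  intro c
  obtain ⟨-, hcfix⟩ := (mem_oneChains_iff σ U S (c : G.edgeSet →₀ V)).1 c.2
  set O : Set Γ := ⋂ e ∈ (c : G.edgeSet →₀ V).support, ({g : Γ | a g (σ.head e) = σ.head e} ∩ {g : Γ | a g (σ.tail e) = σ.tail e} ∩ (U (σ.head e) : Set Γ)) with hO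
  have hOo : IsOpen O := isOpen_biInter_finset fun e _ => ((hstab _).inter (hstab _)).inter (hUo _)
  have hO1 : (1 : Γ) ∈ O := Set.mem_iInter₂.2 fun e _ => ⟨⟨by simp, by simp⟩, (U _).one_mem⟩
  -- an automorphism fixing both ends of an edge fixes the edge
  have hedge : ∀ (g : Γ) (e : G.edgeSet), a g (σ.head e) = σ.head e → a g (σ.tail e) = σ.tail e → (a g⁻¹).mapEdgeSet e = e := by
    intro g e hh ht
    refine FixedSetLocallyConstant.mapEdgeSet_eq_self_of_forall_apply_eq (a g⁻¹ : G →g G) fun v hv => ?_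
    rw [← σ.mk_head_tail e, Sym2.mem_iff] at hv
    rcases hv with rfl | rfl
    · exact act_inv_eq_of_act_eq hh
    · exact act_inv_eq_of_act_eq ht
  have hfix : ∀ g : P, (g : Γ) ∈ O → ρ₁ g c = c := by
    intro g hg
    have hg' : ∀ e ∈ (c : G.edgeSet →₀ V).support, (a (g : Γ) (σ.head e) = σ.head e ∧ a (g : Γ) (σ.tail e) = σ.tail e) ∧ (g : Γ) ∈ U (σ.head e) :=
      fun e he => Set.mem_iInter₂.1 hg e he
    apply Subtype.ext
    rw [hρ₁]
    ext e
    rw [rep_oneChains_apply hτ₁]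
    by_cases he : e ∈ (c : G.edgeSet →₀ V).support
    · obtain ⟨⟨hh, ht⟩, hgU⟩ := hg' e he
      rw [hedge _ e hh ht]
      exact (ρ.mem_fixedPoints _ _).1 (hcfix e) _ (Subgroup.mem_sup_left hgU)
    · have he0 : (c : G.edgeSet →₀ V) e = 0 := Finsupp.notMem_support_iff.1 he
      have he' : (a (g : Γ)⁻¹).mapEdgeSet e ∉ (c : G.edgeSet →₀ V).support := by
        intro hmem
        obtain ⟨⟨hh, ht⟩, -⟩ := hg' _ hmem
        have h1 : (a (g : Γ)).mapEdgeSet ((a (g : Γ)⁻¹).mapEdgeSet e) = e := by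
          rw [← BakerNorine.mapEdgeSet_mul, ← map_mul, mul_inv_cancel, map_one, BakerNorine.mapEdgeSet_one]
        have h2 : (a (g : Γ)).mapEdgeSet ((a (g : Γ)⁻¹).mapEdgeSet e) = (a (g : Γ)⁻¹).mapEdgeSet e :=
          FixedSetLocallyConstant.mapEdgeSet_eq_self_of_forall_apply_eq (a (g : Γ) : G →g G) fun v hv => by
            rw [← σ.mk_head_tail ((a (g : Γ)⁻¹).mapEdgeSet e), Sym2.mem_iff] at hv
            rcases hv with rfl | rfl
            · exact hh
            · exact ht
        rw [h1] at h2
        exact he (h2 ▸ hmem)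
      rw [Finsupp.notMem_support_iff.1 he', map_zero, he0]
  apply Subgroup.isOpen_of_mem_nhds (g := 1)
  exact mem_nhds_iff.2 ⟨((↑) : P → Γ) ⁻¹' O, fun g hg => (ρ₁.mem_stabilizerSubgroup c g).2 (hfix g hg), hOo.preimage continuous_subtype_val, hO1⟩

omit [CharZero k] [DecidableEq ι] in
/-- **`V|_Σ` IS A SMOOTH `P`-REPRESENTATION** (a sub-representation of the smooth `ρ`). [cite: MeyerSolleveld2010, §4 Prop. 4.1] -/
theorem isSmooth_rep_restricted (hρ : ρ.IsSmooth) (U : ι → Subgroup Γ) (S : Set ι) {P : Subgroup Γ} {ρV : Representation k P ↥(⨆ x ∈ S, ρ.fixedPoints (U x))}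
    (hρV : ∀ (g : P) w, ((ρV g w : _) : V) = ρ (g : Γ) w) : ρV.IsSmooth := by
  intro w
  apply Subgroup.isOpen_of_mem_nhds (g := 1)
  refine mem_nhds_iff.2 ⟨((↑) : P → Γ) ⁻¹' (ρ.stabilizerSubgroup (w : V) : Set Γ), fun g hg => ?_, (hρ (w : V)).preimage continuous_subtype_val, ?_⟩
  · exact (ρV.mem_stabilizerSubgroup w g).2 (Subtype.ext ((hρV g w).trans ((ρ.mem_stabilizerSubgroup (w : V) (g : Γ)).1 hg)))
  · show ((1 : P) : Γ) ∈ (ρ.stabilizerSubgroup (w : V) : Set Γ)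
    rw [OneMemClass.coe_one]
    exact (ρ.stabilizerSubgroup (w : V)).one_mem

end Smooth

/-! ## §2 `(V|_Σ)^K = V^K` when `V^K ≤ V|_Σ`: the trace of `γ` on the `K`-invariants of `V|_Σ` is the level-`K` trace `Θ_K(γ)` -/

section Restricted

variable (U : ι → Subgroup Γ) (S : Set ι) {P : Subgroup Γ} {ρV : Representation k P ↥(⨆ x ∈ S, ρ.fixedPoints (U x))}
  (hρV : ∀ (g : P) w, ((ρV g w : _) : V) = ρ (g : Γ) w)

omit [CharZero k] [TopologicalSpace Γ] [IsTopologicalGroup Γ] [DecidableEq ι] in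
/-- `γ ∈ N_Γ(K)`, `K ≤ P`, `γ ∈ P` ⇒ `⟨γ, _⟩ ∈ N_P(K ∩ P)`. [cite: Korman2004, §9 Claim 39] -/
theorem mk_mem_normalizer_subgroupOf {K : Subgroup Γ} {P : Subgroup Γ} {γ : Γ} (hγP : γ ∈ P) (hγK : γ ∈ Subgroup.normalizer (K : Set Γ)) :
    (⟨γ, hγP⟩ : P) ∈ Subgroup.normalizer ((K.subgroupOf P : Subgroup P) : Set P) := by
  rw [Subgroup.mem_normalizer_iff] at hγK ⊢
  intro h
  rw [Subgroup.mem_subgroupOf, Subgroup.mem_subgroupOf]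
  exact hγK h

omit [CharZero k] [TopologicalSpace Γ] [IsTopologicalGroup Γ] [DecidableEq ι] in
include hρV in
/-- Membership in the `K ∩ P`-invariants of `V|_Σ` is membership of the underlying vector in `V^K` (for `K ≤ P`). [cite: MeyerSolleveld2010, §4 Prop. 4.1] -/
theorem mem_fixedPoints_restricted_iff {K : Subgroup Γ} (hKP : K ≤ P) (w : ↥(⨆ x ∈ S, ρ.fixedPoints (U x))) :
    w ∈ ρV.fixedPoints (K.subgroupOf P) ↔ (w : V) ∈ ρ.fixedPoints K := by
  rw [ρV.mem_fixedPoints, ρ.mem_fixedPoints]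
  constructor
  · intro h c hc
    have h' := congrArg Subtype.val (h ⟨c, hKP hc⟩ (Subgroup.mem_subgroupOf.2 hc))
    rwa [hρV] at h'
  · intro h c hc
    exact Subtype.ext ((hρV c w).trans (h _ (Subgroup.mem_subgroupOf.1 hc)))

omit [DecidableEq ι] in
include hρV in
/-- **`tr(γ | (V|_Σ)^K) = Θ_K(γ)`** for `K ≤ P` compact open normalised by `γ ∈ P` with `V^K ≤ V|_Σ`: the `K ∩ P`-invariants of the `P`-representation `V|_Σ` ARE `V^K`, and
the two actions of `γ` agree (`LinearMap.trace_conj'` + ★ TRACE-COSET `levelTrace_eq_trace_restrict_of_mem_normalizer`). [cite: MeyerSolleveld2010, §4 Prop. 4.1]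
[cite: Korman2004, §9 Claim 39] -/
theorem trace_fixedPoints_restricted_eq_levelTrace {K : Subgroup Γ} (hKo : IsOpen (K : Set Γ)) (hKc : IsCompact (K : Set Γ)) (hKP : K ≤ P) {γ : Γ} (hγP : γ ∈ P)
    (hγK : γ ∈ Subgroup.normalizer (K : Set Γ)) (hKV : ρ.fixedPoints K ≤ ⨆ x ∈ S, ρ.fixedPoints (U x)) :
    LinearMap.trace k (ρV.fixedPoints (K.subgroupOf P))
        ((ρV ⟨γ, hγP⟩).restrict (ρV.apply_mem_fixedPoints_of_mem_normalizer (mk_mem_normalizer_subgroupOf hγP hγK))) =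
      ρ.levelTrace hKo hKc γ := by
  rw [ρ.levelTrace_eq_trace_restrict_of_mem_normalizer hKo hKc hγK]
  -- the linear equivalence `(V|_Σ)^{K ∩ P} ≃ V^K`
  let e : ρV.fixedPoints (K.subgroupOf P) ≃ₗ[k] ρ.fixedPoints K :=
    { toFun := fun w => ⟨((w : ↥(⨆ x ∈ S, ρ.fixedPoints (U x))) : V), (mem_fixedPoints_restricted_iff U S hρV hKP _).1 w.2⟩
      map_add' := fun _ _ => rfl
      map_smul' := fun _ _ => rfl
      invFun := fun v => ⟨⟨(v : V), hKV v.2⟩, (mem_fixedPoints_restricted_iff U S hρV hKP _).2 v.2⟩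
      left_inv := fun _ => rfl
      right_inv := fun _ => rfl }
  have hconj : (ρ γ).restrict (ρ.apply_mem_fixedPoints_of_mem_normalizer hγK) =
      e.conj ((ρV ⟨γ, hγP⟩).restrict (ρV.apply_mem_fixedPoints_of_mem_normalizer (mk_mem_normalizer_subgroupOf hγP hγK))) := by
    apply LinearMap.ext
    intro v
    apply Subtype.ext
    rw [LinearMap.restrict_apply, LinearEquiv.conj_apply_apply]
    change ρ γ (v : V) = (((ρV ⟨γ, hγP⟩) (e.symm v)).1 : V)
    rw [hρV]
    rfl
  rw [hconj, LinearMap.trace_conj']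

end Restricted

end Representation
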